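import Mathlib
import Literature.Analysis.FluidPDE.VectorCalculus
import Summits.NavierStokesRegularity.NavierStokesRegularity.Theorems.PlaneEnergyCeilingSlabEnergyIdentityPointwise

/-!
# Route PlaneEnergyCeiling · crux `PlanarEnergyAPriori` — strain-excess identity, pointwise part

Helper file for the crux item stmt-NavierStokesRegularity-16855 (`PlanarEnergyAPriori`, route
`PlaneEnergyCeiling`), landed `--supports` that item. Pointwise calculus behind the kinematic
HALF-SPACE STRAIN-EXCESS IDENTITY of the crux idea `gradient-trace-coulomb`
(`Cruxes/PlanarEnergyAPriori/Ideas/gradient-trace-coulomb.md`, Sketch `HalfSpaceStrainExcessIdentity`):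
for a `C²` divergence-free field `u` on `ℝ³` with strain-excess density
`σ = Σᵢⱼ ∂ᵢuⱼ ∂ⱼuᵢ` (`= |S|² − ½|ω|² = −Δp` along Navier–Stokes),

* `sum_fderiv_fderiv_apply_eq_zero` — the divergence-free constraint differentiated:
  `Σⱼ (D²u(x)(v, eⱼ))ⱼ = 0` for every `v` (`∂ᵥ div u = 0`);
* `sum_fderiv_convect_apply` — `div ((u·∇)u) = σ` (the second-derivative terms are `u·∇(div u) = 0`
  by the symmetry of `D²u`);
* `sum_fderiv_weight_mul_convect` — `Σⱼ ∂ⱼ[(x₂ − c)((u·∇)u)ⱼ] = ((u·∇)u)₂ + (x₂ − c) σ`;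
* `sum_fderiv_apply_mul_apply_two` — `Σⱼ ∂ⱼ(uⱼ u₂) = ((u·∇)u)₂` (divergence-free);
* `divConvect_eq_strainExcess` — registered closed form of `div ((u·∇)u) = σ`.

These are the two divergence forms integrated over slabs in the companion assembly file.
Folklore vector calculus.
-/

noncomputable section

-- single-conjunct summit: `Summit.<Summit>.<Problem>` repeats the name by the D-0017 layout
set_option linter.dupNamespace false

namespace Summit.NavierStokesRegularity.NavierStokesRegularity.Theorems.PlanarEnergyAPriori

open MeasureTheory Set Filter Topology WithLp
open scoped RealInnerProductSpace
open Literature.Analysis.FluidPDE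
open Summit.NavierStokesRegularity.NavierStokesRegularity.Theorems.PlaneEnergyCeilingSlabEnergyIdentity

section Pointwise

variable {u : EuclideanSpace ℝ (Fin 3) → EuclideanSpace ℝ (Fin 3)}

/-- For a `C²` field, `Du` is differentiable with derivative `D²u = fderiv (fderiv u)`. -/
theorem hasFDerivAt_fderiv_of_contDiff_two (hu : ContDiff ℝ 2 u) (x : EuclideanSpace ℝ (Fin 3)) :
    HasFDerivAt (fderiv ℝ u) (fderiv ℝ (fderiv ℝ u) x) x :=
  (((hu.fderiv_right (m := 1) le_rfl).differentiable one_ne_zero) x).hasFDerivAt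

/-- The derivative of a directional-derivative coordinate: `∂ᵥ[(∂_w u)ⱼ] = (D²u(x)(v, w))ⱼ`. -/
theorem hasFDerivAt_fderiv_apply_coord (hu : ContDiff ℝ 2 u) (x w : EuclideanSpace ℝ (Fin 3)) (j : Fin 3) :
    HasFDerivAt (fun y => fderiv ℝ u y w j)
      ((PiLp.proj (𝕜 := ℝ) 2 (fun _ : Fin 3 => ℝ) j).comp
        ((ContinuousLinearMap.apply ℝ (EuclideanSpace ℝ (Fin 3)) w).comp (fderiv ℝ (fderiv ℝ u) x))) x := by
  have h1 : HasFDerivAt (fun y => fderiv ℝ u y w)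
      ((ContinuousLinearMap.apply ℝ (EuclideanSpace ℝ (Fin 3)) w).comp (fderiv ℝ (fderiv ℝ u) x)) x :=
    (ContinuousLinearMap.apply ℝ (EuclideanSpace ℝ (Fin 3)) w).hasFDerivAt.comp x
      (hasFDerivAt_fderiv_of_contDiff_two hu x)
  exact (PiLp.hasFDerivAt_apply (𝕜 := ℝ) 2 (fderiv ℝ u x w) j).comp x h1

/-- **The divergence-free constraint, differentiated.** For a `C²` divergence-free field:
`Σⱼ (D²u(x)(v, eⱼ))ⱼ = 0` for every direction `v` (`∂ᵥ div u = 0`). -/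
theorem sum_fderiv_fderiv_apply_eq_zero (hu : ContDiff ℝ 2 u) (hdiv : VectorCalculus.IsDivFree u)
    (x v : EuclideanSpace ℝ (Fin 3)) :
    ∑ j : Fin 3, fderiv ℝ (fderiv ℝ u) x v (EuclideanSpace.single j 1) j = 0 := by
  -- the divergence as a function, and its derivative
  set L : EuclideanSpace ℝ (Fin 3) →L[ℝ] ℝ := ∑ j : Fin 3, (PiLp.proj (𝕜 := ℝ) 2 (fun _ : Fin 3 => ℝ) j).comp
    ((ContinuousLinearMap.apply ℝ (EuclideanSpace ℝ (Fin 3)) (EuclideanSpace.single j 1)).comp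
      (fderiv ℝ (fderiv ℝ u) x)) with hL
  have hD : HasFDerivAt (fun y => ∑ j : Fin 3, fderiv ℝ u y (EuclideanSpace.single j 1) j) L x := by
    rw [hL]
    exact HasFDerivAt.fun_sum fun j _ => hasFDerivAt_fderiv_apply_coord hu x (EuclideanSpace.single j 1) j
  have hzero : (fun y => ∑ j : Fin 3, fderiv ℝ u y (EuclideanSpace.single j 1) j) =
      fun _ => (0 : ℝ) := by
    funext y
    rw [← divergence_eq_sum_fderiv_apply u y]
    exact hdiv y
  rw [hzero] at hD
  have hL0 : L = 0 := hD.unique (hasFDerivAt_const (0 : ℝ) x)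
  have := congrArg (fun T : EuclideanSpace ℝ (Fin 3) →L[ℝ] ℝ => T v) hL0
  simpa [hL] using this

/-- The derivative of the convective field `(u·∇)u = Du(x)[u(x)]` of a `C²` field:
`∂ᵥ[(u·∇)u] = Du(x)[Du(x)v] + D²u(x)(v, u(x))`. -/
theorem hasFDerivAt_convect (hu : ContDiff ℝ 2 u) (x : EuclideanSpace ℝ (Fin 3)) :
    HasFDerivAt (convect u u)
      ((fderiv ℝ u x).comp (fderiv ℝ u x) + (fderiv ℝ (fderiv ℝ u) x).flip (u x)) x := by
  show HasFDerivAt (fun y => fderiv ℝ u y (u y)) _ x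
  exact (hasFDerivAt_fderiv_of_contDiff_two hu x).clm_apply ((hu.differentiable two_ne_zero) x).hasFDerivAt

/-- The convective field of a `C²` field is `C¹`. -/
theorem contDiff_one_convect (hu : ContDiff ℝ 2 u) : ContDiff ℝ 1 (convect u u) := by
  show ContDiff ℝ 1 (fun y => fderiv ℝ u y (u y))
  exact (hu.fderiv_right (m := 1) le_rfl).clm_apply (hu.of_le one_le_two)

/-- Coordinates of the derivative of the convective field:
`∂ᵥ[((u·∇)u)ⱼ] = (Du(x)[Du(x)v])ⱼ + (D²u(x)(v, u(x)))ⱼ`. -/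
theorem fderiv_convect_apply (hu : ContDiff ℝ 2 u) (x v : EuclideanSpace ℝ (Fin 3)) (j : Fin 3) :
    fderiv ℝ (fun y => convect u u y j) x v =
      fderiv ℝ u x (fderiv ℝ u x v) j + fderiv ℝ (fderiv ℝ u) x v (u x) j := by
  have h : HasFDerivAt (fun y => convect u u y j) ((PiLp.proj (𝕜 := ℝ) 2 (fun _ : Fin 3 => ℝ) j).comp
      ((fderiv ℝ u x).comp (fderiv ℝ u x) + (fderiv ℝ (fderiv ℝ u) x).flip (u x))) x :=
    (PiLp.hasFDerivAt_apply (𝕜 := ℝ) 2 (convect u u x) j).comp x (hasFDerivAt_convect hu x)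
  rw [h.fderiv]
  simp [ContinuousLinearMap.flip_apply]

/-- `(Du(x)[w])ⱼ` expanded in the frame: `(Du(x)[w])ⱼ = Σᵢ (∂ᵢu)ⱼ wᵢ`. -/
theorem fderiv_apply_coord_eq_sum (x w : EuclideanSpace ℝ (Fin 3)) (j : Fin 3) :
    fderiv ℝ u x w j = ∑ i : Fin 3, fderiv ℝ u x (EuclideanSpace.single i 1) j * w i := by
  have h := sum_apply_single_mul ((PiLp.proj (𝕜 := ℝ) 2 (fun _ : Fin 3 => ℝ) j).comp (fderiv ℝ u x)) w
  simpa using h.symm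

/-- **`div ((u·∇)u) = σ`** for a `C²` divergence-free field: the second-derivative terms are
`Σⱼ (D²u(eⱼ, u))ⱼ = Σⱼ (D²u(u, eⱼ))ⱼ = ∂ᵤ div u = 0` by the symmetry of `D²u`, and
`Σⱼ (Du[Du eⱼ])ⱼ = Σᵢⱼ (∂ᵢu)ⱼ (∂ⱼu)ᵢ = σ`. -/
theorem sum_fderiv_convect_apply (hu : ContDiff ℝ 2 u) (hdiv : VectorCalculus.IsDivFree u)
    (x : EuclideanSpace ℝ (Fin 3)) :
    ∑ j : Fin 3, fderiv ℝ (fun y => convect u u y j) x (EuclideanSpace.single j 1) =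
      ∑ i : Fin 3, ∑ j : Fin 3,
        fderiv ℝ u x (EuclideanSpace.single i 1) j * fderiv ℝ u x (EuclideanSpace.single j 1) i := by
  have hsymm : IsSymmSndFDerivAt ℝ u x :=
    (hu.contDiffAt (x := x)).isSymmSndFDerivAt (by simp)
  simp_rw [fderiv_convect_apply hu, Finset.sum_add_distrib]
  have h2 : ∑ j : Fin 3, fderiv ℝ (fderiv ℝ u) x (EuclideanSpace.single j 1) (u x) j = 0 := by
    simp_rw [hsymm.eq _ (u x)]
    exact sum_fderiv_fderiv_apply_eq_zero hu hdiv x (u x)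
  rw [h2, add_zero]
  simp_rw [fderiv_apply_coord_eq_sum x (fderiv ℝ u x (EuclideanSpace.single _ 1))]
  rw [Finset.sum_comm]

/-- The height weight `x ↦ x₂ − c` has derivative the coordinate projection `e₂*`. -/
theorem hasFDerivAt_coord_two_sub (c : ℝ) (y : EuclideanSpace ℝ (Fin 3)) :
    HasFDerivAt (fun y : EuclideanSpace ℝ (Fin 3) => y 2 - c) (PiLp.proj (𝕜 := ℝ) 2 (fun _ : Fin 3 => ℝ) 2) y :=
  (PiLp.hasFDerivAt_apply (𝕜 := ℝ) 2 y (2 : Fin 3)).sub_const c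

/-- The weighted convective flux `φⱼ = (x₂ − c)((u·∇)u)ⱼ` of a `C²` field is `C¹`. -/
theorem contDiff_one_weight_mul_convect (hu : ContDiff ℝ 2 u) (c : ℝ) (j : Fin 3) :
    ContDiff ℝ 1 (fun y : EuclideanSpace ℝ (Fin 3) => (y 2 - c) * convect u u y j) := by
  have h1 : ContDiff ℝ 1 (fun y : EuclideanSpace ℝ (Fin 3) => y 2 - c) :=
    ((PiLp.proj (𝕜 := ℝ) 2 (fun _ : Fin 3 => ℝ) (2 : Fin 3)).contDiff.sub contDiff_const).of_le le_top
  have h2 : ContDiff ℝ 1 (fun y => convect u u y j) :=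
    (PiLp.proj (𝕜 := ℝ) 2 (fun _ : Fin 3 => ℝ) j).contDiff.of_le le_top |>.comp (contDiff_one_convect hu)
  exact h1.mul h2

/-- Leibniz for the weighted convective flux:
`∂ᵥ[(x₂ − c)((u·∇)u)ⱼ] = (x₂ − c)((Du[Du v])ⱼ + (D²u(v,u))ⱼ) + v₂ ((u·∇)u)ⱼ`. -/
theorem fderiv_weight_mul_convect_apply (hu : ContDiff ℝ 2 u) (c : ℝ) (x v : EuclideanSpace ℝ (Fin 3))
    (j : Fin 3) :
    fderiv ℝ (fun y : EuclideanSpace ℝ (Fin 3) => (y 2 - c) * convect u u y j) x v =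
      (x 2 - c) * (fderiv ℝ u x (fderiv ℝ u x v) j + fderiv ℝ (fderiv ℝ u) x v (u x) j) +
        v 2 * convect u u x j := by
  have hV : HasFDerivAt (fun y => convect u u y j) ((PiLp.proj (𝕜 := ℝ) 2 (fun _ : Fin 3 => ℝ) j).comp
      ((fderiv ℝ u x).comp (fderiv ℝ u x) + (fderiv ℝ (fderiv ℝ u) x).flip (u x))) x :=
    (PiLp.hasFDerivAt_apply (𝕜 := ℝ) 2 (convect u u x) j).comp x (hasFDerivAt_convect hu x)
  rw [fderiv_fun_mul (hasFDerivAt_coord_two_sub c x).differentiableAt hV.differentiableAt,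
    (hasFDerivAt_coord_two_sub c x).fderiv, hV.fderiv]
  simp [ContinuousLinearMap.flip_apply]
  ring

/-- **The weighted convective flux is a divergence form**: with `φⱼ = (x₂ − c)((u·∇)u)ⱼ`,
`Σⱼ ∂ⱼφⱼ = ((u·∇)u)₂ + (x₂ − c) σ`. -/
theorem sum_fderiv_weight_mul_convect (hu : ContDiff ℝ 2 u) (hdiv : VectorCalculus.IsDivFree u)
    (c : ℝ) (x : EuclideanSpace ℝ (Fin 3)) :
    ∑ j : Fin 3, fderiv ℝ (fun y : EuclideanSpace ℝ (Fin 3) => (y 2 - c) * convect u u y j) x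
        (EuclideanSpace.single j 1) =
      convect u u x 2 + (x 2 - c) * ∑ i : Fin 3, ∑ j : Fin 3,
        fderiv ℝ u x (EuclideanSpace.single i 1) j * fderiv ℝ u x (EuclideanSpace.single j 1) i := by
  have hterm : ∀ j : Fin 3, fderiv ℝ (fun y : EuclideanSpace ℝ (Fin 3) => (y 2 - c) * convect u u y j) x
      (EuclideanSpace.single j 1) =
      (x 2 - c) * fderiv ℝ (fun y => convect u u y j) x (EuclideanSpace.single j 1) +
        (if j = 2 then convect u u x j else 0) := by
    intro j
    rw [fderiv_weight_mul_convect_apply hu c x _ j, fderiv_convect_apply hu]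
    congr 1
    fin_cases j <;> simp
  simp_rw [hterm, Finset.sum_add_distrib, ← Finset.mul_sum, sum_fderiv_convect_apply hu hdiv x,
    Finset.sum_ite_eq', Finset.mem_univ, if_true]
  ring

/-- The momentum-flux density `ψⱼ = uⱼ u₂` of a `C¹` field is `C¹`. -/
theorem contDiff_one_apply_mul_apply (hu : ContDiff ℝ 1 u) (j : Fin 3) :
    ContDiff ℝ 1 (fun y => u y j * u y 2) :=
  ((PiLp.proj (𝕜 := ℝ) 2 (fun _ : Fin 3 => ℝ) j).contDiff.of_le le_top |>.comp hu).mul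
    ((PiLp.proj (𝕜 := ℝ) 2 (fun _ : Fin 3 => ℝ) (2 : Fin 3)).contDiff.of_le le_top |>.comp hu)

/-- Leibniz for the momentum-flux density: `∂ᵥ(uⱼ u₂) = uⱼ (∂ᵥu)₂ + u₂ (∂ᵥu)ⱼ`. -/
theorem fderiv_apply_mul_apply (hu : Differentiable ℝ u) (x v : EuclideanSpace ℝ (Fin 3)) (j : Fin 3) :
    fderiv ℝ (fun y => u y j * u y 2) x v = u x j * fderiv ℝ u x v 2 + u x 2 * fderiv ℝ u x v j := by
  rw [fderiv_fun_mul (hasFDerivAt_apply_coord hu x j).differentiableAt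
    (hasFDerivAt_apply_coord hu x 2).differentiableAt]
  simp only [add_apply, smul_apply, smul_eq_mul,
    (hasFDerivAt_apply_coord hu x j).fderiv, (hasFDerivAt_apply_coord hu x 2).fderiv,
    ContinuousLinearMap.comp_apply, PiLp.proj_apply]

/-- **`Σⱼ ∂ⱼ(uⱼ u₂) = ((u·∇)u)₂`** for a differentiable divergence-free field. -/
theorem sum_fderiv_apply_mul_apply_two (hu : Differentiable ℝ u) (hdiv : VectorCalculus.IsDivFree u)
    (x : EuclideanSpace ℝ (Fin 3)) :
    ∑ j : Fin 3, fderiv ℝ (fun y => u y j * u y 2) x (EuclideanSpace.single j 1) = convect u u x 2 := by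
  simp_rw [fderiv_apply_mul_apply hu, Finset.sum_add_distrib, ← Finset.mul_sum, ← divergence_eq_sum_fderiv_apply u x, hdiv x,
    mul_zero, add_zero]
  rw [show convect u u x 2 = fderiv ℝ u x (u x) 2 from rfl, fderiv_apply_coord_eq_sum x (u x) 2]
  refine Finset.sum_congr rfl fun j _ => ?_
  ring

/-- **`divConvect_eq_strainExcess`, registered form** (sub-goal of stmt-NavierStokesRegularity-16855;
the pointwise heart of the idea card's `HalfSpaceStrainExcessIdentity`): for a `C²` divergence-free
field on `ℝ³`, `div ((u·∇)u) = Σᵢⱼ ∂ᵢuⱼ ∂ⱼuᵢ` (`= −Δp` along Navier–Stokes). -/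
theorem divConvect_eq_strainExcess : ∀ (u : EuclideanSpace ℝ (Fin 3) → EuclideanSpace ℝ (Fin 3)), ContDiff ℝ 2 u → Literature.Analysis.FluidPDE.VectorCalculus.IsDivFree u → ∀ x : EuclideanSpace ℝ (Fin 3), ∑ j : Fin 3, fderiv ℝ (fun y => Literature.Analysis.FluidPDE.convect u u y j) x (EuclideanSpace.single j 1) = ∑ i : Fin 3, ∑ j : Fin 3, fderiv ℝ u x (EuclideanSpace.single i 1) j * fderiv ℝ u x (EuclideanSpace.single j 1) i :=
  fun _ hu hdiv x => sum_fderiv_convect_apply hu hdiv x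

end Pointwise

end Summit.NavierStokesRegularity.NavierStokesRegularity.Theorems.PlanarEnergyAPriori

end
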